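import Literature.Computability.Complexity.NTIMEHierarchyClock
import Literature.Computability.Complexity.StackBricksArith
import Literature.Computability.Complexity.BranchingFn
import Literature.Computability.Complexity.NSubexp
import HarnessLib

/-!
# Monotonicity of the tree's `NTIME` in the time bound (`NTIME_mono_holds`)

Discharge of the named fact `Literature.Computability.Complexity.NTIME_mono`
(`Nondeterministic.lean`):

  `IsTimeConstructible t → (∀ n, t n ≤ t' n) → NTIME t ⊆ NTIME t'`.

For Arora–Barak's NDTM definition of `NTIME(T(n))` (Def. 2.5: "a `c · T(n)`-time NDTM") the
inclusion is a tautology. The tree's `NTIME t` is the *verifier form* (Def. 2.1 / Thm. 2.6) with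
ONE constant `c` and a WINDOW: the machine of a presentation `(c, R, M)` of `L ∈ NTIME t` is
specified — value `R x y`, time `c · t|x| + c` — only on pairs `⟨x, y⟩` with an admissible
witness `|y| ≤ c · t|x| + c`. Passing to the larger window `c' · t'|x| + c'` therefore needs a
new verifier which first CUTS the witness at exactly the old admissible length (accepting
nothing new, losing no admissible witness) and only then runs `M` — Arora–Barak's remark that
the verifier ignores the part of the certificate it does not need (proof of Thm. 2.6), made into
a machine; computing that length inside the time budget is where time-constructibility of `t`
enters (as in the hierarchy theorems, §3.1). The pieces:

* `not_outputsWithin_zero` — no `TM2` machine produces its output in `0` steps (the initial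
  configuration carries the label `main`, the halting one carries none), so a presentation of
  `L ∈ NTIME t` has `c ≥ 1`;
* `IsTimeConstructible.mul_add` — if `t` is time constructible then so is `n ↦ c · t n + c`
  (`1 ≤ c`): follow the machine `1ⁿ ↦ ⌞t n⌟` by the polynomial-time numeral arithmetic
  `⌞T⌟ ↦ ⌞c T + c⌟` of the tree's `FP` bricks (`Brick.prodFn`, `Brick.addFn`, `fanoutFn`), whose
  time, a polynomial in `|⌞T⌟| ≤ log₂ T + 1`, is `O(T)` (Arora–Barak §1.3: the class of
  time-constructible functions is robust);
* the unary clock `x ↦ ⟨x, 1^{c · t|x| + c}⟩` in time `O(t|x|)`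
  (`exists_unaryClock_of_timeConstructible`, `NTIMEHierarchyClock.lean`, applied to
  `n ↦ c · t n + c`), fed to the truncating wrapper `truncMapAux` (`TruncMapMachine.lean`: on
  `⟨x, y⟩` it outputs `⟨x, y ↾ (c · t|x| + c)⟩`, reading the discarded part of the witness two
  symbols per step);
* `NTIME_mono_holds` — the verifier `truncMapAux N ∘ M` (`Turing.TM2ComputableAux.comp`,
  additive time), the relation `R' x y = R x (y ↾ (c · t|x| + c))`, the constant `c' = 2K` with
  `K = a c + a + 3c + 11` (the half-speed reading of the discarded witness is what lets one
  constant serve both as window and as time bound), exactly as in `NTIMEWindow.lean` (the case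
  `t = 2ⁿ` with the exponential clock).

## References

* S. Arora, B. Barak, *Computational Complexity: A Modern Approach*, CUP 2009: Def. 2.1,
  Def. 2.5 and Thm. 2.6 (pp. 39–42: `NTIME`; certificates vs. nondeterministic choices),
  §1.3 (p. 16: time-constructible functions; robustness), §3.1 (time-constructible bounds in
  the hierarchy theorems). doi:10.1017/cbo9780511804090
* M. Sipser, *Introduction to the Theory of Computation*, 3rd ed., Def. 7.21, Thm. 7.20, Def. 9.8.
-/

namespace Literature.Computability.Complexity

open _root_.Computability Turing Polynomial

/-! ### No output in zero steps -/

/-- **No `TM2` machine outputs anything within `0` steps**: the initial configuration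
`initList` carries the label `some main`, the halting configuration `haltList` carries `none`,
so they differ and at least one step is needed. Consequently the constant `c` of a presentation
of `L ∈ NTIME t` (time bound `c · t|x| + c` on the admissible pair `⟨x, ε⟩`) is never `0`.
[folklore] -/
theorem not_outputsWithin_zero {Γ₀ Γ₁ : Type} (M : TM2ComputableAux Γ₀ Γ₁) (l : List Γ₀)
    (l' : List Γ₁) : ¬ M.OutputsWithin l l' 0 := by
  rintro ⟨h⟩
  have h0 : h.steps = 0 := Nat.le_zero.1 h.steps_le_m
  have e := h.evals_in_steps
  rw [h0] at e
  have e' : initList M.tm (l.map M.inputAlphabet.symm) =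
      haltList M.tm (l'.map M.outputAlphabet.symm) := by
    simpa using e
  have := congrArg TM2.Cfg.l e'
  simp [initList, haltList] at this

/-! ### Time-constructible functions are closed under `t ↦ c · t + c` -/

/-- **`n ↦ c · t n + c` is time constructible when `t` is** (`1 ≤ c`). The map `1ⁿ ↦ ⌞c·t n + c⌟`
is the time-constructibility machine of `t` followed (`Turing.TM2ComputableAux.comp`, additive
time) by the `FP` numeral arithmetic `⌞T⌟ ↦ ⌞c T + c⌟`
(`Brick.addFn ∘ fanoutFn (Brick.prodFn ∘ fanoutFn (const ⌞c⌟) id) (const ⌞c⌟)`); the latter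
costs a polynomial in `|⌞T⌟| ≤ log₂ T + 1`, which is `O(T)` (`exists_eval_le_mul_pow_add`,
`TimeConstructible.exists_pow_le_mul_two_pow`, `Nat.pow_log_le_add_one`). Arora–Barak, §1.3:
the usual closure/robustness of time-constructible bounds. [cite: AroraBarakCC2009, §1.3 (p. 16)] -/
theorem IsTimeConstructible.mul_add {t : ℕ → ℕ} (ht : IsTimeConstructible t) {c : ℕ}
    (hc : 1 ≤ c) : IsTimeConstructible fun n => c * t n + c := by
  obtain ⟨hge, ct, Mt, hMt⟩ := ht
  refine ⟨fun n => ?_, ?_⟩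
  · show n ≤ c * t n + c
    have h1 := hge n
    have h2 : t n ≤ c * t n := Nat.le_mul_of_pos_left _ hc
    omega
  · -- the affine map on numerals is in `FP`
    set A : List Bool → List Bool :=
      Brick.addFn ∘ fanoutFn (Brick.prodFn ∘ fanoutFn (fun _ => encodeNat c) id)
        (fun _ => encodeNat c) with hA
    have hAFP : A ∈ FP :=
      comp_mem_FP Brick.addFn_mem_FP (fanoutFn_mem_FP
        (comp_mem_FP Brick.prodFn_mem_FP
          (fanoutFn_mem_FP (const_mem_FP _) (PolyTimeComputable.id _)))
        (const_mem_FP _))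
    have hAval : ∀ T : ℕ, A (encodeNat T) = encodeNat (c * T + c) := by
      intro T
      simp [hA, fanoutFn_apply, bitsToNat_encodeNat]
    obtain ⟨p, MA, hMA⟩ := hAFP
    -- a polynomial of a logarithmic length is linear
    obtain ⟨c₁, k, hk⟩ := exists_eval_le_mul_pow_add p
    obtain ⟨C, hC⟩ := TimeConstructible.exists_pow_le_mul_two_pow k
    refine ⟨ct + 2 * (c₁ * C) + c₁, Mt.comp MA, fun n => ?_⟩
    have hl : (unaryEncodeNat n).length = n := unary_decode_encode_nat n
    have h1 : Mt.OutputsWithin (unaryEncodeNat n) (encodeNat (t n)) (ct * t n + ct) := by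
      have := hMt n
      dsimp only at this
      rwa [hl] at this
    have h2 : MA.OutputsWithin (encodeNat (t n)) (encodeNat (c * t n + c))
        (p.eval (encodeNat (t n)).length) := by
      have := hMA (encodeNat (t n))
      rwa [hAval] at this
    have h := Turing.TM2ComputableAux.comp_outputsWithin _ _ h1 h2
    dsimp only
    rw [hl]
    refine h.mono ?_
    -- `p |⌞t n⌟| ≤ c₁ C 2^{log₂ (t n) + 1} + c₁ ≤ 2 c₁ C (t n + 1) + c₁`
    have hm : (encodeNat (t n)).length ≤ Nat.log 2 (t n) + 1 := TM2Pass.length_encodeNat_le (t n)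
    have h2m : 2 ^ (encodeNat (t n)).length ≤ 2 * (t n + 1) :=
      calc 2 ^ (encodeNat (t n)).length ≤ 2 ^ (Nat.log 2 (t n) + 1) :=
            Nat.pow_le_pow_right Nat.two_pos hm
        _ = 2 * 2 ^ Nat.log 2 (t n) := by rw [pow_succ, mul_comm]
        _ ≤ 2 * (t n + 1) := Nat.mul_le_mul_left 2 (Nat.pow_log_le_add_one 2 (t n))
    have hp : p.eval (encodeNat (t n)).length ≤ c₁ * (C * (2 * (t n + 1))) + c₁ :=
      (hk _).trans (by
        gcongr
        exact (hC _).trans (Nat.mul_le_mul_left C h2m))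
    have htn : t n ≤ c * t n + c := (Nat.le_mul_of_pos_left _ hc).trans (Nat.le_add_right _ _)
    have hK : (ct + 2 * (c₁ * C) + c₁) * t n ≤ (ct + 2 * (c₁ * C) + c₁) * (c * t n + c) :=
      Nat.mul_le_mul_left _ htn
    have e1 : c₁ * (C * (2 * (t n + 1))) = 2 * (c₁ * C * t n) + 2 * (c₁ * C) := by ring
    have e2 : (ct + 2 * (c₁ * C) + c₁) * t n = ct * t n + 2 * (c₁ * C * t n) + c₁ * t n := by
      ring
    omega

/-! ### Monotonicity of `NTIME` -/

/-- **Discharge of `NTIME_mono`**: for time-constructible `t` and `t ≤ t'` pointwise,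
`NTIME t ⊆ NTIME t'`. Given a presentation `(c, R, M)` of `L ∈ NTIME t` — specified only on
admissible witnesses `|y| ≤ c · t|x| + c`; `c ≥ 1` by `not_outputsWithin_zero` — the new
presentation is the relation `R' x y = R x (y ↾ (c · t|x| + c))`, the verifier
`truncMapAux N ∘ M` where `N : x ↦ ⟨x, 1^{c · t|x| + c}⟩` (time `a (c t|x| + c) + a`) is the unary
clock of the time-constructible `n ↦ c · t n + c` (`IsTimeConstructible.mul_add`,
`exists_unaryClock_of_timeConstructible`): cut the witness at exactly the old admissible
length, reading the discarded part two symbols per step, then run `M` — time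
`K · t'|x| + K + |y| / 2` —, and the constant `c' = 2K`, `K = a c + a + 3c + 11`; the
admissible witnesses of the two presentations certify the same inputs. For Arora–Barak's NDTM
form of `NTIME` (Def. 2.5) the inclusion is immediate; the verifier form is their Thm. 2.6
("use the choices as a certificate" / the verifier ignores the excess certificate), the clock
their use of time-constructibility (§1.3, §3.1).
[cite: AroraBarakCC2009, Def. 2.5 and Thm. 2.6 (§2.1.2, pp. 41–42); §1.3 (p. 16)] -/
theorem NTIME_mono_holds : NTIME_mono := by
  intro t t' ht htt' L hL
  obtain ⟨c, R₀, M, hM, hLR⟩ := hL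
  have hge : ∀ n, n ≤ t n := ht.1
  rcases Nat.eq_zero_or_pos c with rfl | hc
  · -- `c = 0`: the presentation would answer on `⟨ε, ε⟩` within `0` steps
    exact (not_outputsWithin_zero M _ _ (by simpa using hM [] [] (by simp))).elim
  obtain ⟨N, a, hN⟩ := exists_unaryClock_of_timeConstructible (ht.mul_add hc)
  -- the verifier: cut the witness at the old admissible length, then run `M`
  let V : TM2ComputableAux Bool Bool := (truncMapAux N).comp M
  let W : List Bool → ℕ := fun x => c * t x.length + c
  refine ⟨2 * (a * c + a + 3 * c + 11), fun x y => R₀ x (y.take (W x)), V, fun x y hy => ?_,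
    fun x => ?_⟩
  · -- running time on an admissible pair of the new presentation
    have hNx : N.OutputsWithin x (boolPair x (List.replicate (c * t x.length + c) true))
        (a * (c * t x.length + c) + a) := hN x
    have h₁ := outputsWithin_truncMapAux_boolPair N (y := y) hNx
    simp only [List.length_replicate] at h₁
    have hy' : (y.take (W x)).length ≤ c * t x.length + c := List.length_take_le _ _
    have h₂ : M.OutputsWithin (boolPair x (y.take (W x)))
        (encodeBool (R₀ x (y.take (W x)))) (c * t x.length + c) := hM x _ hy'
    have h := Turing.TM2ComputableAux.comp_outputsWithin _ _ h₁ h₂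
    refine h.mono ?_
    have hn : x.length ≤ t x.length := hge x.length
    have ht' : t x.length ≤ t' x.length := htt' x.length
    have hct : c * t x.length ≤ c * t' x.length := Nat.mul_le_mul_left c ht'
    have hact : a * c * t x.length ≤ a * c * t' x.length := Nat.mul_le_mul_left _ ht'
    have e1 : a * (c * t x.length + c) = a * c * t x.length + a * c := by ring
    have e2 : 2 * (a * c + a + 3 * c + 11) * t' x.length = 2 * (a * c * t' x.length) +
        2 * (a * t' x.length) + 6 * (c * t' x.length) + 22 * t' x.length := by ring
    omega
  · -- the admissible witnesses certify the same inputs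
    rw [hLR x]
    constructor
    · rintro ⟨y, hy, hR⟩
      have ht' : t x.length ≤ t' x.length := htt' x.length
      have hct : c * t x.length ≤ c * t' x.length := Nat.mul_le_mul_left c ht'
      refine ⟨y, ?_, ?_⟩
      · have e2 : 2 * (a * c + a + 3 * c + 11) * t' x.length = 2 * (a * c * t' x.length) +
            2 * (a * t' x.length) + 6 * (c * t' x.length) + 22 * t' x.length := by ring
        show y.length ≤ 2 * (a * c + a + 3 * c + 11) * t' x.length + 2 * (a * c + a + 3 * c + 11)
        omega
      · show R₀ x (y.take (W x)) = true
        rwa [List.take_of_length_le hy]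
    · rintro ⟨y, -, hR⟩
      exact ⟨y.take (W x), List.length_take_le _ _, hR⟩

end Literature.Computability.Complexity
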